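import Summits.Ventures.CertifiedManyBodySolver.Rows.RectMarginalNodesSym
import Literature.MathematicalPhysics.QuantumLattice.HubbardSpinFlipSymmetry
import Literature.MathematicalPhysics.QuantumLattice.InfVolFermionStateSpinFlip
import HarnessLib

/-!
# Square-lattice window-marginal nodes — module 7/9: RectMarginalNodesSymTorus

HONEST FRAMING: first certified bounds; not a superconductivity verdict; every number certified or labelled float.
SOUNDNESS / TRANSPORT statements only (inequalities between relaxations and finite-torus / thermodynamic-limit energies); no number is certified here.
THIS module: 7.3 windows of the torus (`injOn_proj_thicken_union_rectWindow`, `TorusOp`, `torusWindowFun…`, `projState_sectorGroundProj_stability_nonneg`) and 7.4 `structure IsSymTorusState` + `isSymTorusState_sectorGround` (the tracial `N`-sector ground state of the `L × L` torus satisfies every torus-side row).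

FILING NOTE (sr-mbsolver-lit-4 g9, 2026-08-22): modules 5–9 `Rows/RectMarginalNodesTW.lean` → `…Sym.lean` → `…SymTorus.lean` → `…SymTransport.lean` → `…SymTL.lean`
continue parts 1–4 (`Rows/RectMarginalNodes.lean` … `Rows/RectMarginalNodesGS.lean`) and are sr-mbsolver-op-07 gen-12's PROVED HOME file
`HOME/sr-mbsolver-op-07/lean/RectMarginalNodes_v3.2.lean` (sha256 d4d4026ae96b32c5…, 2 279 lines, sorry-free, standard axioms; = v3.1 87fe4cef… with the §7.4 proof cut into
`IsSymTorusState` / `isSymTorusState_sectorGround` / `le_div_of_isSymTorusState`) §6b–§7 split per op-07's `FILING-MAP-v3.2.md` (one-writer rule; §8 not filed: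
content-duplicate of pub-hubbard #235 `HubbardAlg/GSWindowNodeD4Sound.lean`), namespace `…CertifiedManyBodySolver.Sketch2D` renamed `Summit.Ventures.CertifiedManyBodySolver.Rows.RectMarginalNodes`;
declarations, statements and proofs VERBATIM (9 one-line docstrings added for the gate's lint; modules 8/9 re-declare the §7.3 `variable {L : ℕ} [NeZero L]` and module 8
re-applies module 7's `DecidableEq (FermionTorus 2 L)` instance as a local instance of priority high (op-07 g13 advisories A1/A2 adopted: minimal imports, no pin in module 9).
-/

noncomputable section

open Matrix Complex Finset Filter Topology
open scoped ComplexOrder MatrixOrder BigOperators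
open Literature.Probability.LatticeModels
open Literature.MathematicalPhysics.QuantumLattice
open Literature.MathematicalPhysics.QuantumLattice.AndersonCluster
open Literature.MathematicalPhysics.QuantumLattice.HubbardWave0
open Literature.MathematicalPhysics.QuantumLattice.ThermodynamicLimit
open Literature.MathematicalPhysics.QuantumManyBody.StateRelaxation

namespace Summit.Ventures.CertifiedManyBodySolver.Rows.RectMarginalNodes

section SymTorus

/-! ### 7.3  Windows of the torus: the pulled-back functional and its rows -/

/-- `[-1,1]² ∪ ([0,a) × [0,b))` fits into every torus of side `L ≥ max (3, a+1, b+1)`. -/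
theorem injOn_proj_thicken_union_rectWindow {L a b : ℕ} (hL : 3 ≤ L) (haL : a + 1 ≤ L) (hbL : b + 1 ≤ L) :
    Set.InjOn (Torus.proj (d := 2) L) ↑(thicken ({0} : Finset (Site 2)) 1 ∪ rectWindow a b) := by
  have hz : ∀ z : Site 2, z ∈ thicken ({0} : Finset (Site 2)) 1 ∪ rectWindow a b →
      ∀ j : Fin 2, -1 ≤ z j ∧ z j + 2 ≤ (L : ℤ) := by
    intro z hz
    rcases Finset.mem_union.1 hz with h | h
    · intro j
      have h1 := abs_apply_le_one_of_mem_thicken_one h j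
      rw [abs_le] at h1
      constructor <;> omega
    · have h1 := mem_rectWindow'.1 h
      rw [Fin.forall_fin_two]
      refine ⟨⟨?_, ?_⟩, ?_, ?_⟩ <;> omega
  intro x hx y hy hxy
  refine Torus.proj_injective_of_abs_sub_lt (fun j => ?_) hxy
  have h1 := hz x (Finset.mem_coe.1 hx) j
  have h2 := hz y (Finset.mem_coe.1 hy) j
  rw [abs_sub_lt_iff]
  constructor <;> omega

variable {L : ℕ} [NeZero L]

/-- (Local.) `DecidableEq` on torus orbit sites from the linear order, as in the torus-certificate files. -/
local instance (priority := high) instDecidableEqFermionTorusSketch : DecidableEq (FermionTorus 2 L) :=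
  LinearOrder.toDecidableEq

/-- The torus many-body algebra. -/
abbrev TorusOp (L : ℕ) [NeZero L] := Matrix (Finset (Orb (FermionTorus 2 L))) (Finset (Orb (FermionTorus 2 L))) ℂ

/-- **The window functional of a torus functional**: `A ↦ ω(Γ(ι_{W,L}) A)` for a window `W` on which `x ↦ x mod L`
is injective. -/
def torusWindowFun (ω : TorusOp L →ₗ[ℂ] ℂ) {W : Finset (Site 2)} (hW : Set.InjOn (Torus.proj (d := 2) L) ↑W) :
    FermionOp W →ₗ[ℂ] ℂ :=
  ω ∘ₗ (fermionEmbed (PolySite.toTorusEmb L hW)).toLinearMap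

/-- The pulled-back window functional, unfolded (definitional). -/
theorem torusWindowFun_apply (ω : TorusOp L →ₗ[ℂ] ℂ) {W : Finset (Site 2)} (hW : Set.InjOn (Torus.proj (d := 2) L) ↑W)
    (A : FermionOp W) : torusWindowFun ω hW A = ω (fermionEmbed (PolySite.toTorusEmb L hW) A) := rfl

/-- **A translation-invariant torus functional has window-LTI density matrices.** -/
theorem windowLTI_densityOfFun_torusWindowFun (ω : TorusOp L →ₗ[ℂ] ℂ) {W : Finset (Site 2)}
    (hW : Set.InjOn (Torus.proj (d := 2) L) ↑W)
    (hconj : ∀ (v : TorusSite 2 L) (Z : TorusOp L), ω (relabel (Orb.translate v) Z) = ω Z) :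
    WindowLTI (densityOfFun (torusWindowFun ω hW)) := by
  intro S v hS hSv A
  rw [trace_densityOfFun_mul, trace_densityOfFun_mul, torusWindowFun_apply, torusWindowFun_apply,
    fermionEmbed_toTorusEmb_incl hS hW, ← fermionEmbed_fermionEmbed, fermionEmbed_toTorusEmb_incl hSv hW,
    fermionEmbed_toTorusEmb_shiftEmb L v (hW.mono (by exact_mod_cast hS)) _ A, hconj]

/-- **A `p4m`-invariant torus functional has `p4m`-symmetric window density matrices.** -/
theorem windowP4m_densityOfFun_torusWindowFun (ω : TorusOp L →ₗ[ℂ] ℂ) {W : Finset (Site 2)}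
    (hW : Set.InjOn (Torus.proj (d := 2) L) ↑W)
    (hconj : ∀ (γ : DihedralGroup 4) (w : TorusSite 2 L) (Z : TorusOp L),
      ω (relabel (Orb.translate w) (relabel (Orb.d4Perm γ) Z)) = ω Z) :
    WindowP4m (densityOfFun (torusWindowFun ω hW)) := by
  intro γ w S hS hS' A
  rw [trace_densityOfFun_mul, trace_densityOfFun_mul, torusWindowFun_apply, torusWindowFun_apply,
    fermionEmbed_toTorusEmb_incl hS hW, ← fermionEmbed_fermionEmbed, fermionEmbed_toTorusEmb_incl hS' hW,
    fermionEmbed_toTorusEmb_d4Emb γ w (hW.mono (by exact_mod_cast hS)) _ A, hconj]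

/-- **A spin-exchange-invariant torus functional has spin-flip-symmetric window density matrices**
(`Γ(ι) ∘ Γ_swap = Γ_swap ∘ Γ(ι)`, `fermionEmbed_relabel_spinSwap`). -/
theorem windowSpinFlip_densityOfFun_torusWindowFun (ω : TorusOp L →ₗ[ℂ] ℂ) {W : Finset (Site 2)}
    (hW : Set.InjOn (Torus.proj (d := 2) L) ↑W)
    (hconj : ∀ Z : TorusOp L, ω (relabel (Orb.spinSwap : Orb (FermionTorus 2 L) ≃ Orb (FermionTorus 2 L)) Z) = ω Z) :
    WindowSpinFlip (densityOfFun (torusWindowFun ω hW)) := by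
  intro A
  rw [trace_densityOfFun_mul, trace_densityOfFun_mul, torusWindowFun_apply, torusWindowFun_apply,
    fermionEmbed_relabel_spinSwap, hconj]

/-- **A torus functional annihilating `[S⁺, ·]` has window density matrices with the `SU(2)`-commutant rows**
(`[S⁺_{torus}, Γ(ι) A] = Γ(ι) [S⁺_W, A]`, `spinPlus_commutator_fermionEmbed`). -/
theorem windowSU2_densityOfFun_torusWindowFun (ω : TorusOp L →ₗ[ℂ] ℂ) {W : Finset (Site 2)}
    (hW : Set.InjOn (Torus.proj (d := 2) L) ↑W)
    (hcomm : ∀ Z : TorusOp L, ω ((spinPlus : TorusOp L) * Z - Z * spinPlus) = 0) :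
    WindowSU2 (densityOfFun (torusWindowFun ω hW)) := by
  intro A
  rw [trace_densityOfFun_mul, torusWindowFun_apply, ← spinPlus_commutator_fermionEmbed]
  exact hcomm _

/-- `Tr(Pᴴ X P) = Σ_i ⟨P e_i, X P e_i⟩` (columns of `P`). -/
theorem trace_conjTranspose_mul_mul_eq_sum {m : Type*} [Fintype m] (P X : Matrix m m ℂ) :
    (Pᴴ * X * P).trace = ∑ i, star (fun k => P k i) ⬝ᵥ (X *ᵥ fun k => P k i) := by
  simp only [Matrix.trace, Matrix.diag_apply, Matrix.mul_apply, Matrix.conjTranspose_apply, dotProduct,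
    Matrix.mulVec, Pi.star_apply, Finset.mul_sum, mul_assoc]

/-- **Local stability of the TRACIAL sector ground state** (Bratteli–Robinson II Prop. 5.3.19, averaged over the
ground multiplet): for Hermitian `H`, a subspace `K`, `P` the orthogonal projection onto the lowest eigenspace of `H`
in `K` and `B` mapping `K` into itself, `ω_P(Bᴴ (H B - B H)) = (Tr P)⁻¹ Σ_i ⟨B P e_i, (H - E₀) B P e_i⟩ ≥ 0`. -/
theorem projState_sectorGroundProj_stability_nonneg {m : Type*} [Fintype m] [DecidableEq m] {H : Matrix m m ℂ}
    (hH : H.IsHermitian) (K : Submodule ℂ (m → ℂ)) {B : Matrix m m ℂ} (hBK : ∀ v ∈ K, B *ᵥ v ∈ K) :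
    0 ≤ (H.sectorGroundProj K).projState (Bᴴ * (H * B - B * H)) := by
  set P := H.sectorGroundProj K with hPdef
  have hPh : P.IsHermitian := sectorGroundProj_isHermitian H K
  have hP2 : P * P = P := sectorGroundProj_mul_self H K
  obtain ⟨hpsd, hPP⟩ := posSemidef_of_proj hPh hP2
  rw [hPP] at hpsd
  rw [Matrix.projState_apply]
  refine mul_nonneg ?_ ?_
  · have hZ : 0 ≤ P.trace := hpsd.trace_nonneg
    obtain ⟨hre, him⟩ := Complex.nonneg_iff.mp hZ
    rw [Complex.nonneg_iff]
    simp [Complex.inv_re, Complex.inv_im, ← him, div_nonneg, hre, Complex.normSq_nonneg]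
  · have e : (P * (Bᴴ * (H * B - B * H))).trace = (Pᴴ * (Bᴴ * (H * B - B * H)) * P).trace := by
      rw [hPh.eq]
      conv_lhs => rw [← hP2, Matrix.mul_assoc, Matrix.trace_mul_comm]
    rw [e, trace_conjTranspose_mul_mul_eq_sum]
    refine Finset.sum_nonneg fun i _ => ?_
    have hcol : (fun k => P k i) = P *ᵥ Pi.single i 1 := by
      ext k
      simp [Matrix.mulVec, dotProduct, Pi.single_apply]
    have hmem := sectorGroundProj_mulVec_mem H K (Pi.single i 1)
    rw [mem_sectorGroundSpace_iff] at hmem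
    rw [hcol]
    exact star_dotProduct_conjTranspose_mul_commutator_mulVec_nonneg hH K hBK hmem.1 hmem.2

/-! ### 7.4  THEOREM (by-value transport): the symmetric node bounds every torus

(v3.2, 2026-08-22 — FILING CUT ONLY, no change of content or of any statement of v3.1: the v3.1 proof of
`LTIRectSymGSNodeTW.le_groundEnergyAt_div` was ONE 362-line tactic block, which cannot sit in a ≤ 400-line gate module.
It is cut at its step (5)/(6) boundary into (a) the ROW PACKAGE `IsSymTorusState t U hL N E ω` of a torus functional
`ω` — normalised, positive, Hermitian; invariant under translations, the affine `D₄` maps and the spin exchange;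
commuting in expectation with `N_σ` and `S⁺`; site densities `N/(2L²)`; local-energy expectation `E/L²`; local
stability `ω(Yᴴ[H_L, Y]) ≥ 0` for every torus operator `Y` commuting with `N̂` —, (b) its INSTANCE on the tracial ground
state of the `N`-particle sector with `E = E₀(torus L, N)` (`isSymTorusState_sectorGround` = v3.1 steps (1)–(5) and the
stability tail, verbatim), and (c) the WINDOW HALF `LTIRectSymGSNodeTW.le_div_of_isSymTorusState` (= v3.1 steps (6)–(9),
verbatim but for reading the torus rows from the package): any `ω` with the package makes the pulled-back window density
matrix feasible for the node, whence `lo ≤ E/L²`.  `le_groundEnergyAt_div` (statement VERBATIM v3.1) is (c) ∘ (b).) -/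

/-- The TORUS-SIDE ROWS consumed by the by-value transport (v3.2 packaging of v3.1 steps (1)–(5)): a linear functional
`ω` on the `L × L` torus algebra that is normalised, positive and Hermitian; invariant under every translation, every
affine `D₄` map `Z ↦ U_w D_γ Z (U_w D_γ)ᴴ` and the spin exchange; whose expectations of commutators with the spin-`σ`
numbers `N_σ` and with `S⁺` vanish; with site densities `ω(n_{xσ}) = (N/2)/L²`; whose expectation of the embedded local
energy observable `Γ(ι_{[-1,1]²}) E_Φ` is `E/L²`; and which is locally stable in the number-conserving direction:
`0 ≤ ω(Yᴴ (H_L Y - Y H_L))` for every torus operator `Y` commuting with `N̂`.  (All fields are `Prop`s; `hL : 3 ≤ L` fixes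
the embedding `ι` of `[-1,1]²`.) -/
structure IsSymTorusState (t U : ℝ) (hL : 3 ≤ L) (N : ℕ) (E : ℝ) (ω : TorusOp L →ₗ[ℂ] ℂ) : Prop where
  one : ω 1 = 1
  nonneg : ∀ B : TorusOp L, 0 ≤ ω (Bᴴ * B)
  conj : ∀ Z : TorusOp L, ω Zᴴ = star (ω Z)
  transl : ∀ (v : TorusSite 2 L) (Z : TorusOp L), ω (relabel (Orb.translate v) Z) = ω Z
  d4 : ∀ (γ : DihedralGroup 4) (w : TorusSite 2 L) (Z : TorusOp L),
    ω (relabel (Orb.translate w) (relabel (Orb.d4Perm γ) Z)) = ω Z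
  swap : ∀ Z : TorusOp L, ω (relabel (Orb.spinSwap : Orb (FermionTorus 2 L) ≃ Orb (FermionTorus 2 L)) Z) = ω Z
  numberComm : ∀ (σ : Fin 2) (Y : TorusOp L),
    ω ((∑ z : FermionTorus 2 L, numberOp z σ) * Y - Y * ∑ z : FermionTorus 2 L, numberOp z σ) = 0
  spinPlusComm : ∀ Y : TorusOp L, ω ((spinPlus : TorusOp L) * Y - Y * spinPlus) = 0
  density : ∀ (x : TorusSite 2 L) (σ : Fin 2),
    ω (numberOp (FermionTorus.ofTorusSite x) σ) = (((N : ℝ) / 2 : ℝ) : ℂ) / (Fintype.card (TorusSite 2 L) : ℂ)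
  energy : ω (fermionEmbed (PolySite.toTorusEmb L (injOn_proj_thicken_one hL))
      ((hubbardFermionInteraction 2 t U).meanEnergyObs 1)) = ((E : ℝ) : ℂ) / (Fintype.card (TorusSite 2 L) : ℂ)
  stab : ∀ Y : TorusOp L, Commute Y totalNumber →
    0 ≤ ω (Yᴴ * (hubbardTorus 2 L t U * Y - Y * hubbardTorus 2 L t U))

/-- **The tracial ground state of the `N`-particle sector carries the rows `IsSymTorusState`, with `E = E₀(torus L, N)`
(as `min` of `H_L` on `nParticleSubmodule N`).**  (v3.1 steps (1)–(5) + the stability tail, verbatim.)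
`P` = the orthogonal projection onto the lowest eigenspace of `H_L` in `nParticleSubmodule N` (all `S^z`),
`ω_P = Tr(P ·)/Tr P`: PSD / trace one (`projState_nonneg/_one`); translation, affine-`D₄` and spin-exchange invariance
(`P` commutes with `U_w`, `U_w D_γ`, `U_swap`: `sectorGroundProj_commute`, `fockTranslate_mul_hubbardTorus`,
`d4Affine_mul_hubbardTorus`, `relabel_spinSwap_hamiltonian`); `N_σ` and `S⁺` commute with `P`
(`hamiltonian_isHermitian_and_commute_holds`, `hamiltonian_commute_spinPlus`) so their commutators have expectation `0`
(cyclicity); densities (`ω(N̂) = N`, `ω(N_↑) = ω(N_↓)` by the spin exchange, `ω(n_{xσ}) = ω(N_σ)/L²` by translations);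
energy (`sum_relabel_translate_hubbard_meanEnergyObs`, `projState_eq_div_of_sum_conj`); stability
(`projState_sectorGroundProj_stability_nonneg`, the sector being preserved by every `Y` commuting with `N̂`). -/
theorem isSymTorusState_sectorGround (t U : ℝ) (hL : 3 ≤ L) {N : ℕ} (hN : N ≤ 2 * L ^ 2) :
    IsSymTorusState t U hL N
      ((hubbardTorus 2 L t U).minEnergyOn (nParticleSubmodule (ι := Orb (FermionTorus 2 L)) N))
      ((hubbardTorus 2 L t U).sectorGroundProj (nParticleSubmodule (ι := Orb (FermionTorus 2 L)) N)).projState := by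
  classical
  have hcard : Fintype.card (FermionTorus 2 L) = L ^ 2 := by
    simp [FermionTorus, Fintype.card_lex]
  have hcardO : Fintype.card (Orb (FermionTorus 2 L)) = 2 * L ^ 2 := by rw [card_orb, hcard]
  -- (1) the tracial ground state of the `N`-particle sector
  set A := hubbardTorus 2 L t U with hAdef
  set K : Submodule ℂ (Fock (Orb (FermionTorus 2 L))) := nParticleSubmodule (ι := Orb (FermionTorus 2 L)) N
    with hKdef
  have hmemK : ∀ ψ, ψ ∈ K ↔ IsNParticle N ψ := fun ψ => Iff.rfl
  have hA : A.IsHermitian := hubbardTorus_isHermitian (hamiltonian_isHermitian_and_commute_holds _) t U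
  have hKA : ∀ ψ ∈ K, A *ᵥ ψ ∈ K := fun ψ hψ =>
    LiebHalfFilled.hamiltonian_mulVec_mem_nParticleSubmodule (fermionTorusGraph 2 L) t U hψ
  have hK : K ≠ ⊥ := by
    obtain ⟨s, -, hs⟩ := Finset.exists_subset_card_eq (s := (Finset.univ : Finset (Orb (FermionTorus 2 L))))
      (n := N) (by rw [Finset.card_univ, hcardO]; exact hN)
    rw [Submodule.ne_bot_iff]
    refine ⟨Pi.single s 1, (hmemK _).2 fun s' hs' => ?_, fun h0 => ?_⟩
    · rw [Pi.single_apply, if_neg]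
      rintro rfl
      exact hs' hs
    · have e := congrFun h0 s
      simp at e
  set P := A.sectorGroundProj K with hPdef
  have hPh : P.IsHermitian := sectorGroundProj_isHermitian A K
  have hP2 : P * P = P := sectorGroundProj_mul_self A K
  have hP0 : P ≠ 0 := sectorGroundProj_ne_zero hA K hKA hK
  have hPA : P * A = ((A.minEnergyOn K : ℝ) : ℂ) • P := sectorGroundProj_mul hA K
  set ω := P.projState with hωdef
  have hone : ω 1 = 1 := projState_one hPh hP2 hP0
  have hpos : ∀ B, 0 ≤ ω (Bᴴ * B) := fun B => projState_nonneg hPh hP2 B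
  have hωh : ∀ Z, ω Zᴴ = star (ω Z) := fun Z => projState_conjTranspose hPh Z
  -- expectations of commutators with operators commuting with `P` vanish (cyclicity of the trace)
  have hωcomm : ∀ Q : TorusOp L, P * Q = Q * P → ∀ Y : TorusOp L, ω (Q * Y - Y * Q) = 0 := by
    intro Q hPQ Y
    have e : ω (Q * Y - Y * Q) = (P.trace)⁻¹ * (P * (Q * Y - Y * Q)).trace := Matrix.projState_apply P _
    rw [e]
    refine mul_eq_zero_of_right _ ?_
    rw [Matrix.mul_sub, Matrix.trace_sub, sub_eq_zero, ← Matrix.mul_assoc, hPQ, Matrix.mul_assoc, Matrix.trace_mul_comm,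
      Matrix.mul_assoc]
  -- Bogoliubov relabelling unitaries preserve the `N`-particle sector
  have hRK : ∀ π : Equiv.Perm (Orb (FermionTorus 2 L)), ∀ ψ ∈ K, (fockRelabel π).val *ᵥ ψ ∈ K :=
    fun π ψ hψ => (hmemK _).2 (((hmemK _).1 hψ).fockRelabel_mulVec π)
  have hRK' : ∀ π : Equiv.Perm (Orb (FermionTorus 2 L)), ∀ ψ ∈ K, (fockRelabel π).valᴴ *ᵥ ψ ∈ K := by
    intro π ψ hψ
    have e : (fockRelabel π).valᴴ = (fockRelabel π.symm).val := by
      rw [fockRelabel_symm, fockRelabel_inv_val, fockRelabel_val]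
    rw [e]
    exact hRK _ ψ hψ
  have hD4K : ∀ γ : DihedralGroup 4, ∀ ψ ∈ K, (fockD4 (L := L) γ).val *ᵥ ψ ∈ K := fun γ ψ hψ => by
    rw [fockD4_apply]; exact hRK _ ψ hψ
  have hD4K' : ∀ γ : DihedralGroup 4, ∀ ψ ∈ K, (fockD4 (L := L) γ).valᴴ *ᵥ ψ ∈ K := fun γ ψ hψ => by
    rw [fockD4_apply]; exact hRK' _ ψ hψ
  -- (2) symmetries commuting with `P`: translations, the affine `D₄` maps, the spin exchange
  have hPT : ∀ w : TorusSite 2 L, P * (fockTranslate w).val = (fockTranslate w).val * P := fun w =>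
    sectorGroundProj_commute hA K (fockTranslate_mul_hubbardTorus w t U) (hRK _) (hRK' _)
  have hTT : ∀ w : TorusSite 2 L, (fockTranslate w).valᴴ * (fockTranslate w).val = 1 :=
    fockTranslate_conjTranspose_mul_self
  have hPD : ∀ (γ : DihedralGroup 4) (w : TorusSite 2 L),
      P * ((fockTranslate w).val * (fockD4 (L := L) γ).val) = ((fockTranslate w).val * (fockD4 (L := L) γ).val) * P :=
    fun γ w => sectorGroundProj_commute hA K (d4Affine_mul_hubbardTorus γ w t U)
      (fun ψ hψ => by rw [← Matrix.mulVec_mulVec]; exact hRK _ _ (hD4K γ ψ hψ))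
      (fun ψ hψ => by rw [Matrix.conjTranspose_mul, ← Matrix.mulVec_mulVec]; exact hD4K' γ _ (hRK' _ ψ hψ))
  have hSA : (fockRelabel (Orb.spinSwap : Orb (FermionTorus 2 L) ≃ Orb (FermionTorus 2 L))).val * A =
      A * (fockRelabel (Orb.spinSwap : Orb (FermionTorus 2 L) ≃ Orb (FermionTorus 2 L))).val :=
    (fockRelabel_commute_of_relabel_eq _ (relabel_spinSwap_hamiltonian (fermionTorusGraph 2 L) t U)).eq
  have hPS : P * (fockRelabel (Orb.spinSwap : Orb (FermionTorus 2 L) ≃ Orb (FermionTorus 2 L))).val =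
      (fockRelabel (Orb.spinSwap : Orb (FermionTorus 2 L) ≃ Orb (FermionTorus 2 L))).val * P :=
    sectorGroundProj_commute hA K hSA (hRK _) (hRK' _)
  have hconjS : ∀ Z : TorusOp L,
      ω (relabel (Orb.spinSwap : Orb (FermionTorus 2 L) ≃ Orb (FermionTorus 2 L)) Z) = ω Z := fun Z => by
    rw [relabel_eq_fockRelabel_conj]
    exact projState_conj hPS (fockRelabel_conjTranspose_mul_self _) Z
  have hconjT : ∀ (v : TorusSite 2 L) (Z : TorusOp L), ω (relabel (Orb.translate v) Z) = ω Z := fun v Z => by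
    rw [relabel_eq_fockRelabel_conj]
    exact projState_conj (hPT v) (hTT v) Z
  have hconjD : ∀ (γ : DihedralGroup 4) (w : TorusSite 2 L) (Z : TorusOp L),
      ω (relabel (Orb.translate w) (relabel (Orb.d4Perm γ) Z)) = ω Z := fun γ w Z => by
    rw [← d4Affine_conj]
    exact projState_conj (hPD γ w) (d4Affine_conjTranspose_mul_self γ w) Z
  -- (3) conserved charges commuting with `P`: the spin-`σ` numbers `N_σ` and the spin-raising operator `S⁺`
  have hHN : A * totalNumber = totalNumber * A :=
    (hamiltonian_isHermitian_and_commute_holds (fermionTorusGraph 2 L) t U).2.1.eq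
  have hHS : A * HubbardWave0.spinZ = HubbardWave0.spinZ * A :=
    (hamiltonian_isHermitian_and_commute_holds (fermionTorusGraph 2 L) t U).2.2.eq
  have hNA : ∀ σ : Fin 2, (∑ z : FermionTorus 2 L, numberOp z σ) * A = A * ∑ z : FermionTorus 2 L, numberOp z σ := by
    intro σ
    rw [sum_numberOp_eq_half_totalNumber_add_spinZ, add_mul, mul_add, smul_mul_assoc, smul_mul_assoc, mul_smul_comm,
      mul_smul_comm, hHN, hHS]
  have hNN : ∀ σ : Fin 2, Commute (totalNumber : TorusOp L) (∑ z : FermionTorus 2 L, numberOp z σ) := fun σ => by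
    rw [totalNumber]
    exact Commute.sum_left _ _ _ fun x _ => Commute.sum_left _ _ _ fun τ _ =>
      Commute.sum_right _ _ _ fun z _ => numberAt_commute (orb x τ) (orb z σ)
  have hNK : ∀ σ : Fin 2, ∀ ψ ∈ K, (∑ z : FermionTorus 2 L, numberOp z σ) *ᵥ ψ ∈ K := fun σ ψ hψ =>
    (hmemK _).2 (LiebTwo.isNParticle_mulVec_of_commute ((hmemK _).1 hψ) (hNN σ).eq)
  have hPN : ∀ σ : Fin 2,
      P * (∑ z : FermionTorus 2 L, numberOp z σ) = (∑ z : FermionTorus 2 L, numberOp z σ) * P := fun σ =>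
    sectorGroundProj_commute hA K (hNA σ) (hNK σ) (fun ψ hψ => by rw [(isHermitian_sum_numberOp σ).eq]; exact hNK σ ψ hψ)
  have hωN : ∀ (σ : Fin 2) (Y : TorusOp L),
      ω ((∑ z : FermionTorus 2 L, numberOp z σ) * Y - Y * ∑ z : FermionTorus 2 L, numberOp z σ) = 0 :=
    fun σ => hωcomm _ (hPN σ)
  have hSpA : (spinPlus : TorusOp L) * A = A * spinPlus :=
    (LiebThm1.hamiltonian_commute_spinPlus (fermionTorusGraph 2 L) t U).eq.symm
  have hSpK : ∀ ψ ∈ K, (spinPlus : TorusOp L) *ᵥ ψ ∈ K := fun ψ hψ =>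
    (hmemK _).2 (LiebTwo.isNParticle_mulVec_of_commute ((hmemK _).1 hψ) LiebTwo.totalNumber_mul_spinPlus)
  have hSpK' : ∀ ψ ∈ K, (spinPlus : TorusOp L)ᴴ *ᵥ ψ ∈ K := fun ψ hψ =>
    (hmemK _).2 (LiebTwo.isNParticle_mulVec_of_commute ((hmemK _).1 hψ) LiebTwo.totalNumber_mul_spinMinus)
  have hPSp : P * spinPlus = spinPlus * P := sectorGroundProj_commute hA K hSpA hSpK hSpK'
  have hωSp : ∀ Y : TorusOp L, ω ((spinPlus : TorusOp L) * Y - Y * spinPlus) = 0 := hωcomm _ hPSp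
  -- (4) densities: `ω(N̂) = N`; `ω(N_↓) = ω(N_↑)` (spin exchange); `ω(n_{xσ}) = ω(N_σ)/L²` (translations)
  have hQK : ∀ ψ ∈ K, (totalNumber : TorusOp L) *ᵥ ψ = (N : ℂ) • ψ := fun ψ hψ =>
    totalNumber_mulVec_of_isNParticle ((hmemK _).1 hψ)
  have hQP : ((totalNumber : TorusOp L) - (N : ℂ) • (1 : TorusOp L)) * P = 0 := sub_smul_mul_sectorGroundProj A K hQK
  have hωtot : ω totalNumber = (N : ℂ) := by
    have e : ω (1 * ((totalNumber : TorusOp L) - (N : ℂ) • (1 : TorusOp L))) = 0 := projState_mul_of_mul_eq_zero hQP 1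
    rw [Matrix.one_mul, map_sub, map_smul, hone, smul_eq_mul, mul_one, sub_eq_zero] at e
    exact e
  have hωswapN : ω (∑ z : FermionTorus 2 L, numberOp z 1) = ω (∑ z : FermionTorus 2 L, numberOp z 0) := by
    have e : relabel (Orb.spinSwap : Orb (FermionTorus 2 L) ≃ Orb (FermionTorus 2 L))
        (∑ z : FermionTorus 2 L, numberOp z 0 : TorusOp L) = ∑ z : FermionTorus 2 L, numberOp z 1 := by
      rw [map_sum]
      exact Finset.sum_congr rfl fun z _ => by rw [relabel_spinSwap_numberOp, Equiv.swap_apply_left]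
    rw [← e, hconjS]
  have hN01 : (∑ z : FermionTorus 2 L, numberOp z 0 : TorusOp L) + ∑ z : FermionTorus 2 L, numberOp z 1 = totalNumber := by
    rw [totalNumber, ← Finset.sum_add_distrib]
    exact Finset.sum_congr rfl fun z _ => (Fin.sum_univ_two _).symm
  have hωN0 : ω (∑ z : FermionTorus 2 L, numberOp z 0) = (((N : ℝ) / 2 : ℝ) : ℂ) := by
    have e : ω (∑ z : FermionTorus 2 L, numberOp z 0) + ω (∑ z : FermionTorus 2 L, numberOp z 0) = (N : ℂ) := by
      rw [← hωtot, ← hN01, map_add, hωswapN]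
    push_cast
    linear_combination e / 2
  have hωNσ : ∀ σ : Fin 2, ω (∑ z : FermionTorus 2 L, numberOp z σ) = (((N : ℝ) / 2 : ℝ) : ℂ) := by
    intro σ
    fin_cases σ
    · exact hωN0
    · exact hωswapN.trans hωN0
  have hωn : ∀ (x : TorusSite 2 L) (σ : Fin 2),
      ω (numberOp (FermionTorus.ofTorusSite x) σ) = (((N : ℝ) / 2 : ℝ) : ℂ) / (Fintype.card (TorusSite 2 L) : ℂ) := by
    intro x σ
    have hs : ∑ w : TorusSite 2 L, ω ((fockTranslate w).val * numberOp (FermionTorus.ofTorusSite x) σ *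
        (fockTranslate w).valᴴ) = ω (∑ z : FermionTorus 2 L, numberOp z σ) := by
      rw [← map_sum, sum_conj_fockTranslate_numberOp]
    have hc : ∀ w : TorusSite 2 L, ω ((fockTranslate w).val * numberOp (FermionTorus.ofTorusSite x) σ *
        (fockTranslate w).valᴴ) = ω (numberOp (FermionTorus.ofTorusSite x) σ) := fun w => by
      rw [← relabel_eq_fockRelabel_conj]
      exact hconjT w _
    simp only [hc, Finset.sum_const, Finset.card_univ, nsmul_eq_mul, hωNσ] at hs
    have hcne : (Fintype.card (TorusSite 2 L) : ℂ) ≠ 0 := Nat.cast_ne_zero.2 Fintype.card_ne_zero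
    rw [eq_div_iff hcne, mul_comm]
    exact hs
  -- (5) the energy: `ω(Γ(ι) E_Φ) = E₀ / L²`
  have hE : ω (fermionEmbed (PolySite.toTorusEmb L (injOn_proj_thicken_one hL))
      ((hubbardFermionInteraction 2 t U).meanEnergyObs 1)) =
      ((A.minEnergyOn K : ℝ) : ℂ) / (Fintype.card (TorusSite 2 L) : ℂ) := by
    have hsum : ∑ w : TorusSite 2 L, (fockTranslate w).val *
        fermionEmbed (PolySite.toTorusEmb L (injOn_proj_thicken_one hL))
          ((hubbardFermionInteraction 2 t U).meanEnergyObs 1) * (fockTranslate w).valᴴ = A := by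
      have e := sum_relabel_translate_hubbard_meanEnergyObs (d := 2) t U hL
      simp_rw [relabel_eq_fockRelabel_conj] at e
      exact e
    exact projState_eq_div_of_sum_conj hPh hP2 hP0 hPA (fun w => (fockTranslate w).val) hPT hTT hsum
  exact
    { one := hone, nonneg := hpos, conj := hωh, transl := hconjT, d4 := hconjD, swap := hconjS, numberComm := hωN,
      spinPlusComm := hωSp, density := hωn, energy := hE,
      stab := fun Y hY => projState_sectorGroundProj_stability_nonneg hA K fun v hv =>
        (hmemK _).2 (LiebTwo.isNParticle_mulVec_of_commute ((hmemK _).1 hv) hY.symm.eq) }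

end SymTorus

end Summit.Ventures.CertifiedManyBodySolver.Rows.RectMarginalNodes

end
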